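import Literature.Computability.MetaComplexity.EFSemantics
import Literature.Computability.MetaComplexity.EFModMulURange
import HarnessLib

/-!
# Semantics of the modular netlists: the modular adder adds and the multiplier multiplies modulo `n`

The covering half of interpolation statements built from the `EF`-proof construction kit
(`EFScaffold.lean` and sequels) needs what the arithmetic templates *compute* on honest inputs
(the constraint lists are instantiated by `Netlist.Inst.assign`, whose gate variables carry the
wire values `Netlist.wireVal`; `Netlist.Inst.sat_assign`). Continuing `EFSemantics.lean` (the
adder adds, the comparator compares), this file computes the words of

* `ModAdd.muxRow` (`ModAdd.wireVal_muxRow`) and `ModMulU.maskRow` (`ModMulU.wval_maskRow`);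
* the uniform modular adder `ModAddU.modAddT L` on `L`-bit words `a, b, n`: the sum bits carry
  `a + b` when `a + b < 2^L` (`ModAddU.wval_s_modAddT`), the comparison bit is `[n ≤ a + b]`
  (`ModAddU.wireVal_ge_modAddT`), and the output word carries
  `R = if n ≤ a + b then a + b - n else a + b` (`ModAddU.wval_R_modAddT`), i.e. `(a + b) mod n`
  for `a, b < n`, `2n ≤ 2^L` (`ModAddU.wval_R_modAddT_mod`);
* the uniform modular multiplier `ModMulU.mulT L` (MSB-first double-and-add): the partial
  products carry `P_s = (a · ⌊b / 2^{L-s}⌋) mod n` (`ModMulU.wval_P_mulT`) and the output word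
  `P_L = (a · b) mod n` (`ModMulU.wval_mulT`), for `a < n` and `2n ≤ 2^L`; the same for the
  product wires of the certified multiplier `ModMulU.mulRT L` (`ModMulU.wval_mulRT`), whose first
  piece is `mulT L` (`ModMulU.wireVal_mulRT`).

## Sources

* H. Vollmer, *Introduction to Circuit Complexity* (Springer 1999), §1.1–1.3 (addition,
  comparison by complement, multiplexers; iterated addition and multiplication as straight-line
  programs) and Def. 1.7 (semantics of circuits).
-/

namespace Literature.Computability.MetaComplexity

open _root_.Computability Complexity Complexity.PropForm Netlist

/-! ### Rows of multiplexers and masks -/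

namespace ModAdd

/-- **The multiplexer row selects**: gate `i` of `muxRow W` on the inputs `[G, d, s]` carries
`G ? dᵢ : sᵢ`. [cite: Vollmer1999, §1.1] -/
theorem wireVal_muxRow (W : ℕ) (inp : ℕ → Bool) {i : ℕ} (hi : i < W) :
    wireVal (muxRow W) inp i = (inp 0 && inp (1 + i) || !inp 0 && inp (1 + W + i)) := by
  rw [wireVal_eq (wf_muxRow W) inp (by simpa using hi), getElem_muxRow]
  rfl

/-- The word of the multiplexer row is the selected word. [cite: Vollmer1999, §1.1] -/
theorem wval_muxRow (W : ℕ) (inp : ℕ → Bool) :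
    wval (fun i => wireVal (muxRow W) inp i) W =
      if inp 0 = true then wval (fun i => inp (1 + i)) W else wval (fun i => inp (1 + W + i)) W := by
  cases h0 : inp 0
  · rw [if_neg (by simp)]
    exact wval_congr fun i hi => by rw [wireVal_muxRow W inp hi, h0]; simp
  · rw [if_pos rfl]
    exact wval_congr fun i hi => by rw [wireVal_muxRow W inp hi, h0]; simp

end ModAdd

namespace ModMulU

/-- **The mask row masks**: gate `i` of `maskRow L` on the inputs `[sel, x]` carries `sel ∧ xᵢ`.
[cite: Vollmer1999, §1.1] -/
theorem wireVal_maskRow (L : ℕ) (inp : ℕ → Bool) {i : ℕ} (hi : i < L) :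
    wireVal (maskRow L) inp i = (inp 0 && inp (1 + i)) := by
  rw [wireVal_eq (wf_maskRow L) inp (by simpa using hi), getElem_maskRow]
  rfl

/-- The word of the mask row is the masked word: `x` if the selector is set, else `0`.
[cite: Vollmer1999, §1.1] -/
theorem wval_maskRow (L : ℕ) (inp : ℕ → Bool) :
    wval (fun i => wireVal (maskRow L) inp i) L = if inp 0 = true then wval (fun i => inp (1 + i)) L else 0 := by
  cases h0 : inp 0
  · rw [if_neg (by simp)]
    exact wval_eq_zero fun i hi => by rw [wireVal_maskRow L inp hi, h0]; simp
  · rw [if_pos rfl]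
    exact wval_congr fun i hi => by rw [wireVal_maskRow L inp hi, h0]; simp

end ModMulU

/-! ### The modular adder -/

namespace ModAddU

variable (L : ℕ) (inp : ℕ → Bool)

/-- The adder part of `modAddT L` carries the wires of `addT false L` on the same inputs.
[cite: Vollmer1999, Def. 1.7] -/
theorem wireVal_modAddT_adder {k : ℕ} (hk : k < (Adder.addT false L).length) :
    wireVal (modAddT L) inp k = wireVal (Adder.addT false L) inp k := by
  have h := wireVal_embed (wf_modAddT L) (Adder.wf_addT false L) (fun k hk => modAddT_adder L hk) inp hk
  rw [Nat.zero_add] at h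
  exact h

/-- The inputs read by the comparator part: the sum bits `s` of the adder and the modulus `n`.
[folklore] -/
def snInp (i : ℕ) : Bool := if i < L then wireVal (Adder.addT false L) inp (2 * i + 1) else inp (2 * L + (i - L))

/-- The comparator part of `modAddT L` carries the wires of `subT L` on `(s, n)`.
[cite: Vollmer1999, Def. 1.7] -/
theorem wireVal_modAddT_sub {k : ℕ} (hk : k < (Sub.subT L).length) :
    wireVal (modAddT L) inp (2 * L + 1 + k) = wireVal (Sub.subT L) (snInp L inp) k := by
  rw [wireVal_embed (wf_modAddT L) (Sub.wf_subT L) (fun k hk => modAddT_sub L hk) inp hk]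
  refine wireVal_congr (Sub.wf_subT L) (fun i hi => ?_) hk
  unfold wD snInp
  split_ifs with h
  · simp only [refVal]
    exact wireVal_modAddT_adder L inp (by simp; omega)
  · rfl

/-- The sum bit `sᵢ` of `modAddT L`. [folklore] -/
theorem wireVal_modAddT_s {i : ℕ} (hi : i < L) :
    wireVal (modAddT L) inp (2 * i + 1) = wireVal (Adder.addT false L) inp (2 * i + 1) :=
  wireVal_modAddT_adder L inp (by simp; omega)

/-- The comparison bit `ge = [S ≥ n]` of `modAddT L`. [folklore] -/
theorem wireVal_modAddT_ge :
    wireVal (modAddT L) inp (5 * L + 1) = wireVal (Sub.subT L) (snInp L inp) (3 * L) := by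
  rw [show 5 * L + 1 = 2 * L + 1 + 3 * L by ring]
  exact wireVal_modAddT_sub L inp (by simp)

/-- The difference bit `dᵢ` of `modAddT L`. [folklore] -/
theorem wireVal_modAddT_d {i : ℕ} (hi : i < L) :
    wireVal (modAddT L) inp (3 * L + 2 + 2 * i) = wireVal (Sub.subT L) (snInp L inp) (L + (2 * i + 1)) := by
  rw [show 3 * L + 2 + 2 * i = 2 * L + 1 + (L + (2 * i + 1)) by ring]
  exact wireVal_modAddT_sub L inp (by simp; omega)

/-- **The output multiplexer**: `Rᵢ = ge ? dᵢ : sᵢ`. [cite: Vollmer1999, §1.1] -/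
theorem wireVal_modAddT_R {i : ℕ} (hi : i < L) :
    wireVal (modAddT L) inp (5 * L + 2 + i) =
      (wireVal (modAddT L) inp (5 * L + 1) && wireVal (modAddT L) inp (3 * L + 2 + 2 * i) ||
        !wireVal (modAddT L) inp (5 * L + 1) && wireVal (modAddT L) inp (2 * i + 1)) := by
  have hlen : 5 * L + 2 + i < (modAddT L).length := by simp; omega
  rw [wireVal_eq (wf_modAddT L) inp hlen, modAddT_mux L hi hlen]
  rfl

/-- The number `a` (inputs `0 … L-1`). [folklore] -/
def valA : ℕ := wval (fun i => inp i) L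
/-- The number `b` (inputs `L … 2L-1`). [folklore] -/
def valB : ℕ := wval (fun i => inp (L + i)) L
/-- The modulus `n` (inputs `2L … 3L-1`). [folklore] -/
def valN : ℕ := wval (fun i => inp (2 * L + i)) L
/-- The number `S` carried by the sum bits. [folklore] -/
def valS : ℕ := wval (fun i => wireVal (modAddT L) inp (2 * i + 1)) L

/-- **The sum bits carry `a + b`** when the sum does not overflow. [cite: Vollmer1999, §1.1] -/
theorem wval_s_modAddT (h : valA L inp + valB L inp < 2 ^ L) : valS L inp = valA L inp + valB L inp := by
  have hA := Adder.wval_sum_addT false L inp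
  have hS : valS L inp = wval (fun i => wireVal (Adder.addT false L) inp (2 * i + 1)) L :=
    wval_congr fun i hi => wireVal_modAddT_s L inp hi
  unfold valA valB at h ⊢
  rw [hS]
  cases hc : wireVal (Adder.addT false L) inp (2 * L) <;> rw [hc] at hA <;>
    simp only [Bool.toNat_false, Bool.toNat_true, Nat.zero_mul, Nat.one_mul, Nat.add_zero] at hA <;> omega

/-- The operands of the comparator part carry `S` and `n`. [folklore] -/
theorem wval_snInp_x : wval (fun i => snInp L inp i) L = valS L inp :=
  wval_congr fun i hi => by unfold snInp; rw [if_pos hi, wireVal_modAddT_s L inp hi]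

/-- The operands of the comparator part carry `S` and `n`. [folklore] -/
theorem wval_snInp_y : wval (fun i => snInp L inp (L + i)) L = valN L inp :=
  wval_congr fun i hi => by unfold snInp; rw [if_neg (by omega), Nat.add_sub_cancel_left]

/-- **The comparison bit compares**: `ge = [n ≤ S]`. [cite: Vollmer1999, §1.1] -/
theorem wireVal_ge_modAddT' : wireVal (modAddT L) inp (5 * L + 1) = decide (valN L inp ≤ valS L inp) := by
  rw [wireVal_modAddT_ge, Sub.wireVal_subT_ge, wval_snInp_x, wval_snInp_y]

/-- **The comparison bit compares**: `ge = [n ≤ a + b]` when the sum does not overflow.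
[cite: Vollmer1999, §1.1] -/
theorem wireVal_ge_modAddT (h : valA L inp + valB L inp < 2 ^ L) :
    wireVal (modAddT L) inp (5 * L + 1) = decide (valN L inp ≤ valA L inp + valB L inp) := by
  rw [wireVal_ge_modAddT', wval_s_modAddT L inp h]

/-- The difference bits carry `S - n` when `n ≤ S`. [cite: Vollmer1999, §1.1] -/
theorem wval_d_modAddT (hge : valN L inp ≤ valS L inp) :
    wval (fun i => wireVal (modAddT L) inp (3 * L + 2 + 2 * i)) L = valS L inp - valN L inp := by
  have h := Sub.wval_subT_d L (snInp L inp) (by rw [wval_snInp_x, wval_snInp_y]; exact hge)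
  rw [wval_snInp_x, wval_snInp_y] at h
  rw [← h]
  exact wval_congr fun i hi => wireVal_modAddT_d L inp hi

/-- **The output word of the modular adder**, in terms of the sum `S`:
`R = if n ≤ S then S - n else S`. [cite: Vollmer1999, §1.1] -/
theorem wval_R_modAddT' :
    wval (fun i => wireVal (modAddT L) inp (5 * L + 2 + i)) L =
      if valN L inp ≤ valS L inp then valS L inp - valN L inp else valS L inp := by
  have hge := wireVal_ge_modAddT' L inp
  by_cases hc : valN L inp ≤ valS L inp
  · rw [if_pos hc, ← wval_d_modAddT L inp hc]
    refine wval_congr fun i hi => ?_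
    rw [wireVal_modAddT_R L inp hi, hge, decide_eq_true hc]
    simp
  · rw [if_neg hc]
    refine wval_congr fun i hi => ?_
    rw [wireVal_modAddT_R L inp hi, hge, decide_eq_false hc]
    simp

/-- **The output word of the modular adder**: `R = if n ≤ a + b then a + b - n else a + b` when
the sum does not overflow. [cite: Vollmer1999, §1.1] -/
theorem wval_R_modAddT (h : valA L inp + valB L inp < 2 ^ L) :
    wval (fun i => wireVal (modAddT L) inp (5 * L + 2 + i)) L =
      if valN L inp ≤ valA L inp + valB L inp then valA L inp + valB L inp - valN L inp
      else valA L inp + valB L inp := by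
  rw [wval_R_modAddT', wval_s_modAddT L inp h]

/-- **The modular adder adds modulo `n`**: for `a, b < n` and `2n ≤ 2^L` the output word carries
`(a + b) mod n`. [cite: Vollmer1999, §1.1] -/
theorem wval_R_modAddT_mod (ha : valA L inp < valN L inp) (hb : valB L inp < valN L inp)
    (hn : 2 * valN L inp ≤ 2 ^ L) :
    wval (fun i => wireVal (modAddT L) inp (5 * L + 2 + i)) L = (valA L inp + valB L inp) % valN L inp := by
  rw [wval_R_modAddT L inp (by omega)]
  split_ifs with hc
  · rw [Nat.mod_eq_sub_mod hc, Nat.mod_eq_of_lt (by omega)]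
  · rw [Nat.mod_eq_of_lt (by omega)]

/-- The output word of the modular adder is below `n` as soon as `a, b < n` (no overflow
needed beyond `a + b < 2^L`). [folklore] -/
theorem wval_R_modAddT_lt (ha : valA L inp < valN L inp) (hb : valB L inp < valN L inp)
    (h : valA L inp + valB L inp < 2 ^ L) :
    wval (fun i => wireVal (modAddT L) inp (5 * L + 2 + i)) L < valN L inp := by
  rw [wval_R_modAddT L inp h]
  split_ifs with hc <;> omega

end ModAddU

/-! ### Bits of a word -/

namespace Netlist

/-- **The bits of the number carried by a word are the bits of the word.** [folklore] -/
theorem testBit_wval (f : ℕ → Bool) {W i : ℕ} (hi : i < W) : (wval f W).testBit i = f i :=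
  (wval_inj (wval_testBit_of_lt (wval_lt f W)) i hi)

/-- Bits of the number carried by a word beyond the width are `false`. [folklore] -/
theorem testBit_wval_of_le (f : ℕ → Bool) {W i : ℕ} (hi : W ≤ i) : (wval f W).testBit i = false :=
  Nat.testBit_eq_false_of_lt ((wval_lt f W).trans_le (Nat.pow_le_pow_right Nat.two_pos hi))

/-- Halving the shift: `⌊b / 2^j⌋ = 2 ⌊b / 2^{j+1}⌋ + bit_j(b)`. [folklore] -/
theorem div_pow_eq_bit (b j : ℕ) : b / 2 ^ j = 2 * (b / 2 ^ (j + 1)) + (b.testBit j).toNat := by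
  rw [Nat.toNat_testBit, Nat.pow_succ, ← Nat.div_div_eq_div_mul]
  exact (Nat.div_add_mod (b / 2 ^ j) 2).symm

end Netlist

/-! ### The modular multiplier -/

namespace ModMulU

variable (L : ℕ) (inp : ℕ → Bool)

/-- Position of bit `i` of the partial product `P_s` inside `mulT L` (the zero gate for `s = 0`,
the output of the accumulating adder `A_{s-1}` otherwise); cf. `ModMulU.View.P`, `ModMulU.LD.pP`.
[folklore] -/
def posP (L s i : ℕ) : ℕ := if s = 0 then 0 else offA L (s - 1) + (5 * L + 2) + i

/-- The output position `P_{s+1}` is the output word of `A_s`. [folklore] -/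
theorem posP_succ (s i : ℕ) : posP L (s + 1) i = offA L s + (5 * L + 2) + i := by
  simp [posP]

/-- The number `a` (inputs `0 … L-1`). [folklore] -/
def valA : ℕ := wval (fun i => inp i) L
/-- The number `b` (inputs `L … 2L-1`). [folklore] -/
def valB : ℕ := wval (fun i => inp (L + i)) L
/-- The modulus `n` (inputs `2L … 3L-1`). [folklore] -/
def valN : ℕ := wval (fun i => inp (2 * L + i)) L
/-- The number carried by the partial product `P_s`. [folklore] -/
def valP (s : ℕ) : ℕ := wval (fun i => wireVal (mulT L) inp (posP L s i)) L

/-- **The zero gate** of the multiplier is `false`. [folklore] -/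
theorem wireVal_mulT_zero : wireVal (mulT L) inp 0 = false := by
  have h := wireVal_layout (pieces L) (N := 3 * L + 1) (piece_ok L) inp (k := 0) (by omega) (j := 0) (by simp [pieces])
  simp only [offset_zero, Nat.zero_add] at h
  unfold mulT
  rw [h, wireVal_eq (nIn := 0) (by
    intro j hj; simp only [pieces, if_true, List.length_singleton, Nat.lt_one_iff] at hj; subst hj
    exact ⟨rfl, fun a ha => absurd ha (by simp [pieces])⟩) _ (by simp [pieces])]
  simp [pieces, Kind.fn]

/-- The partial product `P_0` is the zero word. [folklore] -/
theorem valP_zero : valP L inp 0 = 0 :=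
  wval_eq_zero fun i _ => by simp only [posP, if_true]; exact wireVal_mulT_zero L inp

/-- The inputs read by the doubling adder `D_s`: `(P_s, P_s, n)`. [folklore] -/
def inpD (s : ℕ) (i : ℕ) : Bool :=
  if i < L then wireVal (mulT L) inp (posP L s i) else if i < 2 * L then wireVal (mulT L) inp (posP L s (i - L)) else inp i

/-- The value read through a reference to `P_s`. [folklore] -/
theorem refVal_pRef (s i : ℕ) : refVal inp (wireVal (mulT L) inp) (pRef L s i) = wireVal (mulT L) inp (posP L s i) := by
  unfold pRef posP; split_ifs <;> rfl

/-- **The doubling adder `D_s`** carries the wires of `modAddT L` on `(P_s, P_s, n)`.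
[cite: Vollmer1999, Def. 1.7] -/
theorem wireVal_mulT_D {s : ℕ} (hs : s < L) {j : ℕ} (hj : j < (ModAddU.modAddT L).length) :
    wireVal (mulT L) inp (offD L s + j) = wireVal (ModAddU.modAddT L) (inpD L inp s) j := by
  have h := wireVal_layout (pieces L) (N := 3 * L + 1) (piece_ok L) inp (k := 1 + 3 * s) (by omega) (j := j)
    (by rw [pieces_D]; exact hj)
  simp only [offset_D, pieces_D] at h
  unfold mulT
  rw [h]
  refine wireVal_congr (ModAddU.wf_modAddT L) (fun i hi => ?_) hj
  unfold wD inpD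
  split_ifs with h1 h2
  · exact refVal_pRef L inp s i
  · exact refVal_pRef L inp s (i - L)
  · rfl

/-- **The mask row of stage `s`** carries `b_{L-1-s} ∧ aⱼ`. [cite: Vollmer1999, Def. 1.7] -/
theorem wireVal_mulT_M {s : ℕ} (hs : s < L) {j : ℕ} (hj : j < L) :
    wireVal (mulT L) inp (offM L s + j) = (inp (L + (L - 1 - s)) && inp j) := by
  have h := wireVal_layout (pieces L) (N := 3 * L + 1) (piece_ok L) inp (k := 2 + 3 * s) (by omega) (j := j)
    (by rw [pieces_M]; simpa using hj)
  simp only [offset_M, pieces_M] at h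
  unfold mulT
  rw [h, wireVal_maskRow L _ hj]
  unfold wM
  simp [refVal, Nat.add_comm 1 j]

/-- The inputs read by the accumulating adder `A_s`: `(R(D_s), mk_s, n)`. [folklore] -/
def inpA (s : ℕ) (i : ℕ) : Bool :=
  if i < L then wireVal (mulT L) inp (offD L s + (5 * L + 2) + i)
  else if i < 2 * L then wireVal (mulT L) inp (offM L s + (i - L)) else inp i

/-- **The accumulating adder `A_s`** carries the wires of `modAddT L` on `(R(D_s), mk_s, n)`.
[cite: Vollmer1999, Def. 1.7] -/
theorem wireVal_mulT_A {s : ℕ} (hs : s < L) {j : ℕ} (hj : j < (ModAddU.modAddT L).length) :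
    wireVal (mulT L) inp (offA L s + j) = wireVal (ModAddU.modAddT L) (inpA L inp s) j := by
  have h := wireVal_layout (pieces L) (N := 3 * L + 1) (piece_ok L) inp (k := 3 + 3 * s) (by omega) (j := j)
    (by rw [pieces_A]; exact hj)
  simp only [offset_A, pieces_A] at h
  unfold mulT
  rw [h]
  refine wireVal_congr (ModAddU.wf_modAddT L) (fun i hi => ?_) hj
  unfold wA inpA
  split_ifs with h1 h2 <;> rfl

/-- The operands of `D_s` carry `P_s`, `P_s`, `n`. [folklore] -/
theorem val_inpD (s : ℕ) :
    ModAddU.valA L (inpD L inp s) = valP L inp s ∧ ModAddU.valB L (inpD L inp s) = valP L inp s ∧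
      ModAddU.valN L (inpD L inp s) = valN L inp := by
  refine ⟨wval_congr fun i hi => ?_, wval_congr fun i hi => ?_, wval_congr fun i hi => ?_⟩ <;> unfold inpD
  · rw [if_pos hi]
  · rw [if_neg (by omega), if_pos (by omega), Nat.add_sub_cancel_left]
  · rw [if_neg (by omega), if_neg (by omega)]

/-- **The doubled word**: `R(D_s)` carries `2 P_s mod n` (for `P_s < n`, `2n ≤ 2^L`).
[cite: Vollmer1999, §1.1] -/
theorem wval_RD_mulT {s : ℕ} (hs : s < L) (hP : valP L inp s < valN L inp) (hn : 2 * valN L inp ≤ 2 ^ L) :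
    wval (fun i => wireVal (mulT L) inp (offD L s + (5 * L + 2) + i)) L = (2 * valP L inp s) % valN L inp := by
  obtain ⟨hA, hB, hN⟩ := val_inpD L inp s
  have h := ModAddU.wval_R_modAddT_mod L (inpD L inp s) (by rw [hA, hN]; exact hP) (by rw [hB, hN]; exact hP) (by rw [hN]; exact hn)
  rw [hA, hB, hN, ← two_mul] at h
  rw [← h]
  exact wval_congr fun i hi => by rw [Nat.add_assoc]; exact wireVal_mulT_D L inp hs (j := 5 * L + 2 + i) (by simp; omega)

/-- **The mask word** of stage `s` carries `bit_{L-1-s}(b) · a`. [cite: Vollmer1999, §1.1] -/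
theorem wval_M_mulT {s : ℕ} (hs : s < L) :
    wval (fun i => wireVal (mulT L) inp (offM L s + i)) L = ((valB L inp).testBit (L - 1 - s)).toNat * valA L inp := by
  unfold valB
  rw [testBit_wval _ (by omega)]
  cases hb : inp (L + (L - 1 - s))
  · simp only [Bool.toNat_false, Nat.zero_mul]
    exact wval_eq_zero fun i hi => by rw [wireVal_mulT_M L inp hs hi, hb, Bool.false_and]
  · simp only [Bool.toNat_true, Nat.one_mul]
    exact wval_congr fun i hi => by rw [wireVal_mulT_M L inp hs hi, hb, Bool.true_and]

/-- The operands of `A_s` carry `R(D_s)`, `mk_s`, `n`. [folklore] -/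
theorem val_inpA (s : ℕ) :
    ModAddU.valA L (inpA L inp s) = wval (fun i => wireVal (mulT L) inp (offD L s + (5 * L + 2) + i)) L ∧
      ModAddU.valB L (inpA L inp s) = wval (fun i => wireVal (mulT L) inp (offM L s + i)) L ∧
      ModAddU.valN L (inpA L inp s) = valN L inp := by
  refine ⟨wval_congr fun i hi => ?_, wval_congr fun i hi => ?_, wval_congr fun i hi => ?_⟩ <;> unfold inpA
  · rw [if_pos hi]
  · rw [if_neg (by omega), if_pos (by omega), Nat.add_sub_cancel_left]
  · rw [if_neg (by omega), if_neg (by omega)]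

/-- **One stage of double-and-add**: `P_{s+1} = (2 P_s + bit_{L-1-s}(b) · a) mod n`, for
`a < n`, `P_s < n`, `2n ≤ 2^L`. [cite: Vollmer1999, §1.2–1.3] -/
theorem valP_succ {s : ℕ} (hs : s < L) (ha : valA L inp < valN L inp) (hP : valP L inp s < valN L inp)
    (hn : 2 * valN L inp ≤ 2 ^ L) :
    valP L inp (s + 1) = (2 * valP L inp s + ((valB L inp).testBit (L - 1 - s)).toNat * valA L inp) % valN L inp := by
  obtain ⟨hA, hB, hN⟩ := val_inpA L inp s
  have hNpos : 0 < valN L inp := by omega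
  have hRD := wval_RD_mulT L inp hs hP hn
  have hM := wval_M_mulT L inp hs
  have hA' : ModAddU.valA L (inpA L inp s) < valN L inp := by rw [hA, hRD]; exact Nat.mod_lt _ hNpos
  have hB' : ModAddU.valB L (inpA L inp s) < valN L inp := by
    rw [hB, hM]
    cases (valB L inp).testBit (L - 1 - s) <;> simp <;> omega
  have h := ModAddU.wval_R_modAddT_mod L (inpA L inp s) (by rw [hN]; exact hA') (by rw [hN]; exact hB') (by rw [hN]; exact hn)
  rw [hA, hB, hN, hRD, hM, Nat.mod_add_mod] at h
  rw [← h]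
  exact wval_congr fun i hi => by rw [posP_succ, Nat.add_assoc]; exact wireVal_mulT_A L inp hs (j := 5 * L + 2 + i) (by simp; omega)

/-- **The invariant of double-and-add**: `P_s = (a · ⌊b / 2^{L-s}⌋) mod n` and `P_s < n` for
`s ≤ L` (`a < n`, `2n ≤ 2^L`). [cite: Vollmer1999, §1.2–1.3] -/
theorem wval_P_mulT (ha : valA L inp < valN L inp) (hn : 2 * valN L inp ≤ 2 ^ L) :
    ∀ {s : ℕ}, s ≤ L → valP L inp s = (valA L inp * (valB L inp / 2 ^ (L - s))) % valN L inp
  | 0, _ => by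
    rw [valP_zero, Nat.sub_zero, Nat.div_eq_of_lt (show valB L inp < 2 ^ L from wval_lt _ L), Nat.mul_zero, Nat.zero_mod]
  | s + 1, hs => by
    have hNpos : 0 < valN L inp := by omega
    have ih := wval_P_mulT ha hn (s := s) (by omega)
    have hq : valB L inp / 2 ^ (L - (s + 1)) = 2 * (valB L inp / 2 ^ (L - s)) + ((valB L inp).testBit (L - (s + 1))).toNat := by
      rw [show L - s = L - (s + 1) + 1 by omega]; exact div_pow_eq_bit _ _
    rw [valP_succ L inp (by omega) ha (by rw [ih]; exact Nat.mod_lt _ hNpos) hn, ih, hq,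
      show L - 1 - s = L - (s + 1) by omega]
    calc _ ≡ 2 * (valA L inp * (valB L inp / 2 ^ (L - s))) + ((valB L inp).testBit (L - (s + 1))).toNat * valA L inp
          [MOD valN L inp] := ((Nat.mod_modEq _ _).mul_left 2).add_right _
      _ = _ := by ring

/-- **The modular multiplier multiplies modulo `n`**: the output word `P_L` of `mulT L` carries
`(a · b) mod n`, for `a < n` and `2n ≤ 2^L`. [cite: Vollmer1999, §1.2–1.3] -/
theorem wval_mulT (ha : valA L inp < valN L inp) (hn : 2 * valN L inp ≤ 2 ^ L) :
    valP L inp L = (valA L inp * valB L inp) % valN L inp := by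
  rw [wval_P_mulT L inp ha hn le_rfl, Nat.sub_self, Nat.pow_zero, Nat.div_one]

/-- The output word of the multiplier is below `n` (for `a < n`, `2n ≤ 2^L`). [folklore] -/
theorem valP_lt (ha : valA L inp < valN L inp) (hn : 2 * valN L inp ≤ 2 ^ L) {s : ℕ} (hs : s ≤ L) :
    valP L inp s < valN L inp := by
  rw [wval_P_mulT L inp ha hn hs]; exact Nat.mod_lt _ (by omega)

/-! ### The certified multiplier -/

/-- **The first piece of the certified multiplier is the multiplier**: the wires of `mulRT L`
below `ML L` carry the wires of `mulT L` on the same inputs. [cite: Vollmer1999, Def. 1.7] -/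
theorem wireVal_mulRT {k : ℕ} (hk : k < (mulT L).length) : wireVal (mulRT L) inp k = wireVal (mulT L) inp k := by
  have h := wireVal_layout (rpieces L) (N := 3 * L + 3) (rpiece_ok L) inp (k := 0) (by omega) (j := k)
    (by simp only [rpieces, if_true]; exact hk)
  simp only [offset_zero, Nat.zero_add, rpieces, if_true] at h
  unfold mulRT
  rw [h]
  exact wireVal_congr (wf_mulT L) (fun i hi => rfl) hk

/-- The positions of the partial products lie inside the multiplier. [folklore] -/
theorem posP_lt_length {s i : ℕ} (hs : s ≤ L) (hi : i < L) : posP L s i < (mulT L).length := by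
  unfold posP; split_ifs with h
  · simp
  · simp only [length_mulT, offA, offD]
    have h1 : (s - 1) * (13 * L + 4) + (13 * L + 4) ≤ L * (13 * L + 4) := by
      rw [← Nat.succ_mul]; exact Nat.mul_le_mul_right _ (by omega)
    omega

/-- The partial products of the certified multiplier are those of the multiplier. [folklore] -/
theorem wval_P_mulRT (s : ℕ) (hs : s ≤ L) :
    wval (fun i => wireVal (mulRT L) inp (posP L s i)) L = valP L inp s :=
  wval_congr fun _ hi => wireVal_mulRT L inp (posP_lt_length L hs hi)

/-- **The certified multiplier multiplies modulo `n`**: its output word carries `(a · b) mod n`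
(`a < n`, `2n ≤ 2^L`). [cite: Vollmer1999, §1.2–1.3] -/
theorem wval_mulRT (ha : valA L inp < valN L inp) (hn : 2 * valN L inp ≤ 2 ^ L) :
    wval (fun i => wireVal (mulRT L) inp (posP L L i)) L = (valA L inp * valB L inp) % valN L inp := by
  rw [wval_P_mulRT L inp L le_rfl, wval_mulT L inp ha hn]

end ModMulU

end Literature.Computability.MetaComplexity
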